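import Summits.CriticalPhenomena.PercolationContinuityZ3.Theorems.PercNearOneGluingNoHeavyQuantAdditiveGluingTransfer
import Literature.Probability.Percolation.KozmaNitzanTargetLemma
import HarnessLib

/-!
# QUANT lane (R2): Steps II and V of Kozma–Nitzan's Lemma 10 in ADDITIVE form

builds on p205010 (kernel theorem, internal audit signed; external expert review pending)

Cell `prim-quant` (post-continuity programme, LANE 1), seat `prim-quant-p2` (METHOD = effective Kozma–Nitzan
reduction), memo `run/shared/lean/prim/quant/P2-EFFECTIVE-KN.md` §1 (step S2, first half).

Kozma–Nitzan's Lemma 10 (arXiv:2401.12397 §4, pp. 17–22; tree `KozmaNitzan.targetLemma`,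
`Literature/Probability/Percolation/KozmaNitzanTargetLemma.lean`) is proved in the tree from Conjecture 3 in its
threshold form, which forces Step V to SPLIT the shell patterns `ξ` into good and bad ones by a Markov inequality and
costs the product `δ = ε·δ_{C3}(ε/2)/12`.  With the ADDITIVE gluing inequality (tree theorem `AdditiveGluing`,
stmt-CriticalPhenomena-4576, transported in `…QuantAdditiveGluingTransfer.lean`) the split is unnecessary: the
inequality `P_{K_ξ}(o ↔ T) ≥ φ_ξ − δ` holds in EVERY contraction graph `K_ξ` and can be AVERAGED over `ξ`.  This file
provides the two steps of the tree proof that change: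

* `Quant.stepII_defect` — Step II (a level with many contacts) in defect form: `P(Fail_jᶜ) ≥ P(o ↔ B) − δ`
  (the tree's `LHyp.stepII` concludes `1 − 2δ < P(Fail_jᶜ)` from `1 − δ < P(o ↔ B)`; same proof);
* `Quant.stepV_additive` — Step V with additive gluing: from Step II (defect form), the seed bound (19) and the
  Step-IV face estimate, `P(o ↔ T) ≥ P(o ↔ B) − 6δ`.

The assembly (scale-indexed hypotheses, explicit margin) is `…QuantEffectiveTargetLemma.lean`.
No definitions; no sorries; standard axioms.  [cite: KozmaNitzan2024, §4 Lemma 10 (pp. 17–22)]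
-/

noncomputable section

namespace Summit.CriticalPhenomena.PercolationContinuityZ3.Theorems.Quant

open MeasureTheory Literature.Probability.LatticeModels Literature.Probability.Percolation
  Literature.Probability.Percolation.KozmaNitzan

variable {d : ℕ}

/-! ## Step II in defect form -/

open Classical in
/-- **Step II of Lemma 10 in defect form** (KN p. 18; tree `LHyp.stepII`): if the level range `J = [j₀, j₁]`,
`j₁ ≤ R`, has at least `(1−p)^{−2dN}/δ` levels, then at some level `j ∈ J` the event "fewer than `N` contact
vertices" costs at most `δ` on `{o ↔ B}`: `P(Fail_jᶜ) ≥ P(o ↔ B) − δ`.  Same proof as the tree's (tails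
`P(o ↔ B, t ≤ #fails) ≤ r^t`, `Σ_j P(o ↔ B, Fail_j) ≤ 1/q`, pigeonhole), with the last line kept additive.
[cite: KozmaNitzan2024, §4 p. 18 (Step II)] -/
theorem stepII_defect {L : LData d} {W : Sym2 (Site d) → unitInterval} {p : unitInterval} {D : Finset (Site d)}
    {R : ℕ} (hL : LHyp L W p D R) (hp1 : (p : ℝ) < 1) {N j₀ j₁ : ℕ} (hj₁ : j₁ ≤ R) {δ : ℝ}
    (hJ : 1 / (1 - (p : ℝ)) ^ (2 * d * N) ≤ δ * ((Finset.Icc j₀ j₁).card : ℝ)) :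
    ∃ j ∈ Finset.Icc j₀ j₁,
      (prodBernoulli W).real L.reachB - δ ≤ (prodBernoulli W).real (L.Fail N j)ᶜ := by
  set μ := prodBernoulli W with hμ
  set J := Finset.Icc j₀ j₁ with hJdef
  have hJle : ∀ j ∈ J, j ≤ R := fun j hj => (Finset.mem_Icc.1 hj).2.trans hj₁
  set q : ℝ := (1 - (p : ℝ)) ^ (2 * d * N) with hq
  have hq0 : 0 < q := pow_pos (by linarith) _
  have hq1 : q ≤ 1 := pow_le_one₀ (sub_nonneg.2 p.2.2) (sub_le_self _ p.2.1)
  set r : ℝ := 1 - q with hr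
  have hr0 : 0 ≤ r := by rw [hr]; linarith
  have hr1 : r < 1 := by rw [hr]; linarith
  -- `J` is nonempty
  have hJne : J.Nonempty := by
    rw [← Finset.card_pos]
    by_contra h0
    push Not at h0
    have : (J.card : ℝ) = 0 := by exact_mod_cast Nat.le_zero.1 h0
    rw [this, mul_zero] at hJ
    have : 0 < 1 / q := by positivity
    linarith
  -- tails: `P(o ↔ B, t ≤ #fails) ≤ r^t`
  have htail : ∀ t ∈ Finset.Icc 1 J.card,
      μ.real (L.reachB ∩ {ω | t ≤ (J.filter fun j => ω ∈ L.Fail N j).card}) ≤ r ^ t := by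
    intro t ht
    have ht1 : 1 ≤ t := (Finset.mem_Icc.1 ht).1
    have hcov : L.reachB ∩ {ω | t ≤ (J.filter fun j => ω ∈ L.Fail N j).card} ⊆
        L.Aev N J t ∪ (LData.PosOnly W)ᶜ := by
      intro ω hω
      by_cases hpos : ω ∈ LData.PosOnly W
      · exact Or.inl (hL.reachB_inter_subset_Aev hJle ht1 ⟨⟨hω.1, hpos⟩, hω.2⟩)
      · exact Or.inr hpos
    calc _ ≤ μ.real (L.Aev N J t ∪ (LData.PosOnly W)ᶜ) := measureReal_mono hcov
      _ ≤ μ.real (L.Aev N J t) + μ.real (LData.PosOnly W)ᶜ := measureReal_union_le _ _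
      _ ≤ r ^ t := by rw [hμ, LData.real_compl_posOnly W, add_zero]; exact hL.real_Aev_le hJle t
  -- the sum over levels is at most `1/q`
  have hsum : ∑ j ∈ J, μ.real (L.reachB ∩ L.Fail N j) ≤ 1 / q := by
    rw [hμ, LHyp.sum_real_inter_Fail_eq (L := L) N J (LHyp.measurableSet_reachB (L := L))]
    calc _ ≤ ∑ t ∈ Finset.Icc 1 J.card, r ^ t := Finset.sum_le_sum htail
      _ ≤ ∑ t ∈ Finset.range (J.card + 1), r ^ t := by
          refine Finset.sum_le_sum_of_subset_of_nonneg (fun t ht => ?_) (fun t _ _ => pow_nonneg hr0 t)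
          rw [Finset.mem_range]; rw [Finset.mem_Icc] at ht; omega
      _ = (r ^ (J.card + 1) - 1) / (r - 1) := geom_sum_eq hr1.ne _
      _ ≤ 1 / q := by
          have e1 : (r ^ (J.card + 1) - 1) / (r - 1) = (1 - r ^ (J.card + 1)) / q := by
            have hq' : r - 1 = -q := by rw [hr]; ring
            rw [hq', div_neg, ← neg_div, neg_sub]
          rw [e1]
          exact div_le_div_of_nonneg_right (by linarith [pow_nonneg hr0 (J.card + 1)]) hq0.le
  -- some level has `P(o ↔ B, Fail_j) ≤ δ`
  obtain ⟨j, hj, hjle⟩ := Finset.exists_le_of_sum_le hJne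
    (f := fun j => μ.real (L.reachB ∩ L.Fail N j)) (g := fun _ => (1 / q) / J.card) (by
      rw [Finset.sum_const, nsmul_eq_mul, mul_div_cancel₀ _ (by exact_mod_cast hJne.card_pos.ne')]
      exact hsum)
  refine ⟨j, hj, ?_⟩
  have hjδ : μ.real (L.reachB ∩ L.Fail N j) ≤ δ := by
    refine hjle.trans ?_
    rw [div_le_iff₀ (by exact_mod_cast hJne.card_pos)]
    exact hJ
  -- `P(Fail_jᶜ) ≥ P(o ↔ B) - P(o ↔ B, Fail_j)`
  have hsplit : μ.real L.reachB ≤ μ.real (L.reachB ∩ L.Fail N j) + μ.real (L.Fail N j)ᶜ := by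
    rw [← measureReal_inter_add_sdiff (s := L.reachB) (LHyp.measurableSet_Fail (L := L) N j)]
    refine add_le_add le_rfl (measureReal_mono fun ω hω => hω.2)
  linarith

/-! ## Step V, additive -/

open Classical in
/-- **Step V of Lemma 10 with ADDITIVE gluing** (KN pp. 21–22 re-run; tree `LHyp.stepV_in`): the averaged seed
estimate `Σ_ξ p_ξ φ_ξ ≥ (1−3δ)·P(𝒢)` (KN (26)+(25)+(20); the tree's Claim D verbatim) is combined with the additive
gluing inequality `P_{K_ξ}(o ↔ T) ≥ φ_ξ − δ` in EVERY contraction graph `K_ξ` (relay set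
`A_ξ = {u ∈ S : P(u ↔ T inside Rg | ξ) > 1 − δ}`, so every relay is `δ`-reliable to `T`; tree theorem
`Quant.additiveGluing_finSupp_set`) and summed over `ξ` with weights `p_ξ` (`prodBernoulli_real_inter_eq_sum_pinW`):
no split into good and bad patterns.  Inputs: Step II in defect form (`P(Fail_jᶜ) ≥ P(o ↔ B) − δ`), the seed bound
(19) `(1 − p^{seedBound d M})^k ≤ δ`, the face estimate of `stepIV_in` at threshold `δ` for every potential
contact.  Output: `P(o ↔ T) ≥ P(o ↔ B) − 6δ` (defects: Step II `δ`, Step III `δ`, Step IV `3δ`, gluing `δ`).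
builds on p205010 (kernel theorem, internal audit signed; external expert review pending).
[cite: KozmaNitzan2024, §4 pp. 21–22 (Step V, (25)–(26))] -/
theorem stepV_additive [NeZero d] {L : LData d} {W : Sym2 (Site d) → unitInterval} {p : unitInterval}
    {D : Finset (Site d)} {R : ℕ} (hL : LHyp L W p D R) {Rg : Set (Site d)} {j M k : ℕ} (hj : j ≤ R)
    (hwide : ∀ k, L.Lo j k + 2 * M + 2 ≤ L.Hi j k)
    {S T : Finset (Site d)} (hS : S ⊆ Finset.Icc (L.Lo j + 1) (L.Hi j - 1)) (hSD : S ⊆ D)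
    (hTS : T ⊆ L.Sfin) (hTne : T.Nonempty) {δ : ℝ} (hδ : 0 < δ)
    (hII : (prodBernoulli W).real L.reachB - δ ≤ (prodBernoulli W).real (L.Fail (LData.Ncont d M k) j)ᶜ)
    (hIII : (1 - (p : ℝ) ^ seedBound d M) ^ k ≤ δ)
    (hUS : ∀ x ∈ outerBoundary (zdGraph d) (L.X j), L.ufaceX j M x ⊆ S)
    (hIV : ∀ x ∈ outerBoundary (zdGraph d) (L.X j),
      1 - 3 * δ ≤ (prodBernoulli W).real {ω | ∃ u ∈ L.ufaceX j M x,
        1 - δ < (prodBernoulli (pinW W (wireSet (↑S : Set (Site d))) ω)).real (⋃ t ∈ T, openConnIn Rg u t)}) :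
    (prodBernoulli W).real L.reachB - 6 * δ ≤ (prodBernoulli W).real (⋃ t ∈ T, openConn L.o t) := by
  set μ := prodBernoulli W with hμ
  set OB := outerBoundary (zdGraph d) (L.X j) with hOB
  set F := pairsF S with hF
  have hFS : (↑F : Set (Sym2 (Site d))) = wireSet (↑S : Set (Site d)) := coe_pairsF S
  have hSfin : S ⊆ L.Sfin := hSD.trans hL.DS
  -- the good sets `A_ξ` and the quantities `φ_ξ`
  set Aof : Finset (Sym2 (Site d)) → Finset (Site d) := fun P => S.filter fun u =>
    1 - δ < (prodBernoulli (pinW W (wireSet (↑S : Set (Site d))) ↑P)).real (⋃ t ∈ T, openConnIn Rg u t) with hAof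
  set φ : Finset (Sym2 (Site d)) → ℝ := fun P =>
    (prodBernoulli (pinW W ↑F ↑P)).real (⋃ a ∈ Aof P, openConn L.o a) with hφ
  set cyl : Finset (Sym2 (Site d)) → Set (BondConfig (Site d)) := fun P => localCylinder ↑F ↑P with hcyl
  -- `μ(𝒢) ≥ μ(o ↔ B) - 2δ`
  have hmG : MeasurableSet (L.Gev j M k) := by
    rw [← LData.biUnion_Fx_eq_Gev]
    exact Finset.measurableSet_biUnion _ fun x hx => LData.measurableSet_Fx hx
  have hG : μ.real L.reachB - 2 * δ ≤ μ.real (L.Gev j M k) := by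
    have h1 := hL.real_manyContacts_diff_Gev_le (j := j) (M := M) (k := k) hj hwide
    have h2 : μ.real (L.Fail (LData.Ncont d M k) j)ᶜ ≤
        μ.real ((L.Fail (LData.Ncont d M k) j)ᶜ \ L.Gev j M k) + μ.real (L.Gev j M k) := by
      rw [← measureReal_inter_add_sdiff (s := (L.Fail (LData.Ncont d M k) j)ᶜ) hmG, add_comm]
      exact add_le_add le_rfl (measureReal_mono Set.inter_subset_right)
    linarith
  have hGle : μ.real (L.Gev j M k) ≤ 1 := measureReal_le_one
  -- Claim D: `Σ_P μ(cyl P) φ(P) ≥ (1 - 3δ) μ(𝒢)` (verbatim from the tree's Step V)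
  have hGood_det : ∀ x, DeterminedBy {ω | ∃ u ∈ L.ufaceX j M x,
      1 - δ < (prodBernoulli (pinW W (wireSet (↑S : Set (Site d))) ω)).real (⋃ t ∈ T, openConnIn Rg u t)} ↑F := by
    intro x
    rw [determinedBy_iff]
    intro ω ω' hω
    simp only [Set.mem_setOf_eq]
    have hag : ∀ e ∈ wireSet (↑S : Set (Site d)), e ∈ ω ↔ e ∈ ω' := by
      intro e he
      rw [← hFS] at he
      have := Set.ext_iff.1 hω e
      simp only [Set.mem_inter_iff] at this
      exact ⟨fun h' => (this.1 ⟨h', he⟩).1, fun h' => (this.2 ⟨h', he⟩).1⟩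
    refine exists_congr fun u => and_congr_right fun _ => ?_
    rw [pinW_congr W hag]
  have hFx_pin : ∀ P, ∀ x ∈ OB, (prodBernoulli (pinW W ↑F ↑P)).real (L.Fx j M k x) = μ.real (L.Fx j M k x) := by
    intro P x hx
    rw [hμ]
    refine (prodBernoulli_real_eq_of_determinedBy W _ (F := (↑F : Set (Sym2 (Site d)))ᶜ)
      (fun e he => (pinW_apply_of_not_mem W ↑P he).symm) ?_ (LData.measurableSet_Fx hx)).symm
    rw [hFS]
    exact LData.determinedBy_Fx hwide hS hx
  have hφ_ge : ∀ P, P ⊆ F →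
      ∑ x ∈ OB.filter (fun x => ∃ u ∈ L.ufaceX j M x, u ∈ Aof P), μ.real (L.Fx j M k x) ≤ φ P := by
    intro P hP
    have hsub : (⋃ x ∈ OB.filter (fun x => ∃ u ∈ L.ufaceX j M x, u ∈ Aof P), L.Fx j M k x) ⊆
        ⋃ a ∈ Aof P, openConn L.o a := by
      intro ω hω
      simp only [Set.mem_iUnion, exists_prop, Finset.mem_filter] at hω ⊢
      obtain ⟨x, ⟨hxO, u, hu, huA⟩, hFx⟩ := hω
      exact ⟨u, huA, LData.openConn_of_mem_oSeed hwide hxO (LData.Fx_subset_oSeed x hFx) hu⟩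
    calc _ = ∑ x ∈ OB.filter (fun x => ∃ u ∈ L.ufaceX j M x, u ∈ Aof P),
            (prodBernoulli (pinW W ↑F ↑P)).real (L.Fx j M k x) :=
          Finset.sum_congr rfl fun x hx => (hFx_pin P x (Finset.mem_filter.1 hx).1).symm
      _ = (prodBernoulli (pinW W ↑F ↑P)).real
            (⋃ x ∈ OB.filter (fun x => ∃ u ∈ L.ufaceX j M x, u ∈ Aof P), L.Fx j M k x) := by
          rw [measureReal_biUnion_finset]
          · intro x hx x' hx' hne
            exact LData.Fx_disjoint hne (Finset.mem_filter.1 hx').1 (Finset.mem_filter.1 hx).1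
          · intro x hx; exact LData.measurableSet_Fx (Finset.mem_filter.1 hx).1
      _ ≤ φ P := measureReal_mono hsub (measure_ne_top _ _)
  have hD : (1 - 3 * δ) * μ.real (L.Gev j M k) ≤ ∑ P ∈ F.powerset, μ.real (cyl P) * φ P := by
    have hGx : ∀ x ∈ OB, μ.real {ω | ∃ u ∈ L.ufaceX j M x,
        1 - δ < (prodBernoulli (pinW W (wireSet (↑S : Set (Site d))) ω)).real (⋃ t ∈ T, openConnIn Rg u t)} =
        ∑ P ∈ F.powerset.filter (fun P => ∃ u ∈ L.ufaceX j M x, u ∈ Aof P), μ.real (cyl P) := by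
      intro x hx
      rw [hμ, prodBernoulli_real_eq_sum_localCylinder W F (hGood_det x)]
      refine Finset.sum_congr ?_ fun P _ => rfl
      ext P
      simp only [Finset.mem_filter, Finset.mem_powerset, Set.mem_setOf_eq, hAof, and_congr_right_iff]
      intro _
      constructor
      · rintro ⟨u, hu, hg⟩; exact ⟨u, hu, hUS x hx hu, hg⟩
      · rintro ⟨u, hu, -, hg⟩; exact ⟨u, hu, hg⟩
    calc (1 - 3 * δ) * μ.real (L.Gev j M k)
        = ∑ x ∈ OB, (1 - 3 * δ) * μ.real (L.Fx j M k x) := by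
          rw [← LData.biUnion_Fx_eq_Gev, measureReal_biUnion_finset, Finset.mul_sum]
          · intro x hx x' hx' hne; exact LData.Fx_disjoint hne hx' hx
          · intro x hx; exact LData.measurableSet_Fx hx
      _ ≤ ∑ x ∈ OB, μ.real {ω | ∃ u ∈ L.ufaceX j M x,
            1 - δ < (prodBernoulli (pinW W (wireSet (↑S : Set (Site d))) ω)).real (⋃ t ∈ T, openConnIn Rg u t)} *
            μ.real (L.Fx j M k x) :=
          Finset.sum_le_sum fun x hx => mul_le_mul_of_nonneg_right (hIV x hx) measureReal_nonneg
      _ = ∑ x ∈ OB, ∑ P ∈ F.powerset.filter (fun P => ∃ u ∈ L.ufaceX j M x, u ∈ Aof P),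
            μ.real (cyl P) * μ.real (L.Fx j M k x) := by
          refine Finset.sum_congr rfl fun x hx => ?_
          rw [hGx x hx, Finset.sum_mul]
      _ = ∑ P ∈ F.powerset, ∑ x ∈ OB.filter (fun x => ∃ u ∈ L.ufaceX j M x, u ∈ Aof P),
            μ.real (cyl P) * μ.real (L.Fx j M k x) := by
          rw [Finset.sum_comm' (t' := F.powerset)
            (s' := fun P => OB.filter (fun x => ∃ u ∈ L.ufaceX j M x, u ∈ Aof P))]
          intro x P
          simp only [Finset.mem_filter, Finset.mem_powerset]
          tauto
      _ = ∑ P ∈ F.powerset, μ.real (cyl P) *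
            ∑ x ∈ OB.filter (fun x => ∃ u ∈ L.ufaceX j M x, u ∈ Aof P), μ.real (L.Fx j M k x) := by
          refine Finset.sum_congr rfl fun P _ => ?_
          rw [Finset.mul_sum]
      _ ≤ ∑ P ∈ F.powerset, μ.real (cyl P) * φ P :=
          Finset.sum_le_sum fun P hP => mul_le_mul_of_nonneg_left (hφ_ge P (Finset.mem_powerset.1 hP)) measureReal_nonneg
  -- total mass of the cylinders is `1`
  have hcyl_sum : ∑ P ∈ F.powerset, μ.real (cyl P) = 1 := by
    have := prodBernoulli_real_eq_sum_localCylinder W F (determinedBy_univ (↑F : Set (Sym2 (Site d))))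
    rw [probReal_univ] at this
    rw [hμ, this]
    refine (Finset.sum_congr ?_ fun P _ => rfl)
    ext P; simp
  -- ADDITIVE gluing in every contraction graph `K_ξ`
  have hF : ∀ P ∈ F.powerset,
      φ P - δ ≤ (prodBernoulli (pinW W ↑F ↑P)).real (⋃ t ∈ T, openConn L.o t) := by
    intro P _
    have hsupp : FinSupp (pinW W ↑F ↑P) L.Sfin := by rw [hFS]; exact hL.finSupp_pinW hSfin ↑P
    refine additiveGluing_finSupp_set (pinW W ↑F ↑P) L.Sfin hsupp.zero (Aof P) T L.o Rg
      ((Finset.filter_subset _ _).trans hSfin) hTS hL.o_mem hTne hδ.le fun a ha => ?_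
    have hga := (Finset.mem_filter.1 ha).2
    rw [← hFS] at hga
    exact hga.le
  -- conclusion: total probability over the patterns
  have hmT : MeasurableSet (⋃ t ∈ T, openConn L.o t : Set (BondConfig (Site d))) :=
    Finset.measurableSet_biUnion _ fun t _ => measurableSet_openConn_holds _ _
  have htot := prodBernoulli_real_inter_eq_sum_pinW W F hmT (determinedBy_univ (↑F : Set (Sym2 (Site d))))
  rw [Set.inter_univ] at htot
  simp only [Set.mem_univ, Finset.filter_true] at htot
  have hsum_ge : ∑ P ∈ F.powerset, μ.real (cyl P) * φ P - δ ≤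
      ∑ P ∈ F.powerset, μ.real (cyl P) * (prodBernoulli (pinW W ↑F ↑P)).real (⋃ t ∈ T, openConn L.o t) := by
    have h1 : ∑ P ∈ F.powerset, μ.real (cyl P) * (φ P - δ) ≤
        ∑ P ∈ F.powerset, μ.real (cyl P) * (prodBernoulli (pinW W ↑F ↑P)).real (⋃ t ∈ T, openConn L.o t) :=
      Finset.sum_le_sum fun P hP => mul_le_mul_of_nonneg_left (hF P hP) measureReal_nonneg
    have h2 : ∑ P ∈ F.powerset, μ.real (cyl P) * (φ P - δ) =
        ∑ P ∈ F.powerset, μ.real (cyl P) * φ P - δ := by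
      simp only [mul_sub, Finset.sum_sub_distrib, ← Finset.sum_mul, hcyl_sum, one_mul]
    linarith
  have h3δ : μ.real (L.Gev j M k) - 3 * δ ≤ (1 - 3 * δ) * μ.real (L.Gev j M k) := by nlinarith
  rw [hμ] at hsum_ge
  rw [htot]
  linarith

end Summit.CriticalPhenomena.PercolationContinuityZ3.Theorems.Quant

end
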